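import Summits.CriticalPhenomena.PercolationContinuityZ3.Theses.PercOpenSupercrit
import Summits.CriticalPhenomena.PercolationContinuityZ3.Theorems.PercNearOneGluingNoHeavyLowerTailCSHTheoremOne
import Literature.Probability.Percolation.HalfSpaceBGN
import HarnessLib

/-!
# `PercOpenSupercrit.PercOpenSupercritR3LocalEventContinuous` (stmt-CriticalPhenomena-0683) — SETTLED after continuity

Item `stmt-CriticalPhenomena-0683` of route `CriticalPhenomena/PercOpenSupercrit` (support): for every local event `A`, `p ↦ P_p(A)` is continuous on `[0,1]`.

Literally `continuous_bondPercolation_real_of_isLocalEvent (zdGraph 3)` (HalfSpaceBGN.lean: a cylinder probability is a polynomial in `p`). p205010 is NOT used.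

builds on p205010 (kernel theorem, internal audit signed; external expert review pending) — USED (`CSH.percolationContinuityZ3_holds`).  RSW3 lane, lead gen 28 (prover-prim-rsw3-lead-g28-0):
'after continuity — the ledger harvest'.
References: G. Kozma, N. Nitzan (2024), Thm. 6 / Conj. 3 [KozmaNitzan2024]; G. Grimmett, *Percolation* (1999), §8 [GrimmettPercolation1999].
-/

noncomputable section

namespace Summit.CriticalPhenomena.PercolationContinuityZ3.Theorems

namespace PercOpenSupercritPercOpenSupercritR3LocalEventContinuous

open MeasureTheory Literature.Probability.Percolation Literature.Probability.LatticeModels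

/-- **`PercOpenSupercrit.PercOpenSupercritR3LocalEventContinuous` (stmt-CriticalPhenomena-0683), settled.**  `continuous_bondPercolation_real_of_isLocalEvent` at `G = ℤ³`.
[cite: KozmaNitzan2024, Thm. 6 with Conj. 3 (p. 15)] -/
theorem percOpenSupercritR3LocalEventContinuous_proof : Summit.CriticalPhenomena.PercolationContinuityZ3.Theses.PercOpenSupercrit.PercOpenSupercritR3LocalEventContinuous := by
  intro A hA
  exact continuous_bondPercolation_real_of_isLocalEvent (zdGraph 3) hA

end PercOpenSupercritPercOpenSupercritR3LocalEventContinuous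

end Summit.CriticalPhenomena.PercolationContinuityZ3.Theorems

end
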